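import Literature.AnabelianGeometry.AbsoluteAnabelian.AbsTopIII.ReconstructionThm19Functorial
import Literature.AnabelianGeometry.AbsoluteAnabelian.AbsTopIII.ReconstructionToyInstances
import HarnessLib

/-!
# [AbsTopIII] Thm. 1.9 with its functoriality clause (`Thm_1_9'`): a NON-DEGENERATE satisfiability witness

S. Mochizuki, *Topics in Absolute Anabelian Geometry III*, J. Math. Sci. Univ. Tokyo **22** (2015) [AbsTopIII],
Thm. 1.9 pp. 37–38 and Rmk. 1.9.5 (i) p. 39 (author's manuscript pagination, lit key `paper:url-5493eb38cbb7`).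

Cell `abc-iut`, seat abc-iut-c312-2 (L4 lineage; X-143 owner by RULINGS #352).  The strengthened named fact
`Thm_1_9' M ρ` (`ReconstructionThm19Functorial.lean`, cure L-c of ERRATA-L5 X-143) asks for an
`NFPortionAlgorithm` whose TYPED FUNCTORIALITY (`map` along isomorphisms of extensions, TOTAL `comap` along
open injections with `comap_map`, total `comapBase`) intertwines, at the recorded curves, the transport along
INNER isomorphisms `innerIso g` with the model's recorded Galois action `ρ`.  The tree's NEG lemma
`Thm_1_9'.not_witnessedBy_of_isInnerTrivialAt` shows the clause has teeth — no inner-trivial ("read off a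
representative") algorithm witnesses it where `ρ` moves an element — but the only inhabitant on record is the
DEGENERATE one (constant algorithm, trivial action; `exists_reconstructionFacts_nonVacuous` via `toThm_1_9`),
at which the clause is idle.  abc-iut-c312-2 gen 13 recorded the design obstacle («`comap` must be TOTAL over
open injections with `comap_map`; a rename-based carrier has no contravariant field hom along injections
(transcendence degree), a constant carrier kills the inner action; design open»).

THIS FILE closes that design question with a NON-DEGENERATE witness (junk/toy data, zero anabelian content):

* carrier: ONE field `K₀ := Frac(ℚ̄_NF[X_h : h ∈ Π₀])` — rational functions over the NF-constants `ℚ̄_NF ⊆ ℚ̄`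
  in variables indexed by the toy group `Π₀ := G_ℚ × 𝔖₃` of abc-iut-f-076's `toyExt ℚ 𝔖₃` — used as the
  function-field output at EVERY extension (so `comap`/`comapBase` can be identities off isomorphisms), with
  `permField π : K₀ ≃ₐ[ℚ̄_NF] K₀` the renaming along a permutation `π` of `Π₀`;
* transport: `map e` for `e : E ≅ F` is TRIVIAL unless `E ≅ E₀ := toyExt ℚ 𝔖₃`, and is then the renaming along
  the automorphism `(anchor E)⁻¹ ≫ e ≫ anchor F` of `E₀`, where `anchor E : E ≅ E₀` is a CHOSEN isomorphism,
  rigged to be the identity at `E₀` itself — a functor from the groupoid of extensions to `Aut(K₀)`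
  (`map_id`, `map_comp` PROVED) whose value on `innerIso g` at `E₀` is renaming by CONJUGATION by `g`
  (`toyMapFun_innerIso`), non-trivial since `𝔖₃` is non-abelian; `comap f := (map f)⁻¹` on isomorphisms and
  `id` otherwise (`comap_map` PROVED), `comapBase := id`;
* model: abc-iut-f-076's `toyModel ℚ 𝔖₃` with `K_{Z_NF} := K₀` (`toyModelNV`), one recorded curve, recorded
  action `ρ₀ : g ↦ permField (conj g)`;
* `Thm_1_9'.witnessedBy_toyAlg` — `WitnessedBy toyModelNV ρ₀ toyAlg`; `Thm_1_9'.toyModelNV` — `Thm_1_9'` HOLDS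
  there; `ρ₀_moves` — the recorded action MOVES an element at a Thm-1.9 INPUT curve (`ℚ` is sub-`p`-adic);
  hence `toyAlg_not_isInnerTrivialAt` and the packaged `Thm_1_9'.exists_witness_nondegenerate`:
  `∃ M ρ A i, WitnessedBy M ρ A ∧ IsThm19Input (ρ.curve i) ∧ (∃ g f, ρ.act i g f ≠ f) ∧ ¬ A.IsInnerTrivialAt _`.

HONEST LABEL — TOY / JUNK: the algorithm has no anabelian content (it never looks at its input beyond "is it
isomorphic to `E₀`?"), the model is not a model of any curve, and the witness certifies ONLY that the typed
clause `Thm_1_9'` — total functoriality fields included — is jointly satisfiable by a NON-inner-trivial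
algorithm at a curve where the recorded action is non-trivial (LANA Rem. 8.2.1 vacuity discipline for a
strengthened fact typed by name).  Nothing of [AbsTopIII] is proved; nothing here bears on [IUTchIII] Cor. 3.12
or asserts that abc is proved or refuted; typed ≠ inhabited-at-a-toy ≠ proved-in-print.  No `instance`, no
notation, no axiom, no `sorry`.
-/

noncomputable section

open CategoryTheory
open scoped Pointwise

namespace Literature.AnabelianGeometry.AbsoluteAnabelian.AbsTopIII

namespace Thm19FunctorialNV

open CurveModelSchemaWitness

/-! ### The carrier -/

/-- The anchor extension `E₀ := (G_ℚ × 𝔖₃ ↠ G_ℚ)` (abc-iut-f-076's `toyExt ℚ 𝔖₃`).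
[cite: MochizukiAbsTopIII2015, Thm 1.9 p.37] -/
abbrev E₀ : FundamentalExtension.{0} := toyExt ℚ S₃

/-- The NF-constants `ℚ̄_NF ⊆ ℚ̄` of the toy base `ℚ` (= `(toyModel ℚ 𝔖₃).kbarNF _`).
[cite: MochizukiAbsTopIII2015, Def 1.7 p.35] -/
abbrev C₀ : Type := ↥((toyModel ℚ S₃).kbarNF PUnit.unit)

/-- The polynomial ring `ℚ̄_NF[X_h : h ∈ Π₀]`. [cite: MochizukiAbsTopIII2015, Thm 1.9 (e) p.38] -/
abbrev P₀ : Type := MvPolynomial E₀.arith C₀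

/-- The carrier field `K₀ := Frac(ℚ̄_NF[X_h : h ∈ Π₀])`. [cite: MochizukiAbsTopIII2015, Thm 1.9 (e) p.38] -/
abbrev K₀ : Type := FractionRing P₀

/-- Renaming the variables along a permutation of `Π₀`, as a `ℚ̄_NF`-algebra automorphism of `K₀`.
[cite: MochizukiAbsTopIII2015, Thm 1.9 p.38] -/
def permField (π : Equiv.Perm E₀.arith) : K₀ ≃ₐ[C₀] K₀ :=
  IsFractionRing.algEquivOfAlgEquiv (MvPolynomial.renameEquiv C₀ π)

/-- `permField π` on (the image of) a polynomial is `rename π`. [cite: MochizukiAbsTopIII2015, Thm 1.9 p.38] -/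
theorem permField_algebraMap (π : Equiv.Perm E₀.arith) (p : P₀) :
    permField π (algebraMap P₀ K₀ p) = algebraMap P₀ K₀ (MvPolynomial.rename π p) := by
  rw [permField, IsFractionRing.algEquivOfAlgEquiv_algebraMap]
  rfl

/-- Ring endomorphisms of `K₀` are determined on polynomials. [cite: MochizukiAbsTopIII2015, Thm 1.9 p.38] -/
theorem ringHom_ext_K₀ {S : Type*} [Semiring S] {f g : K₀ →+* S}
    (h : ∀ p : P₀, f (algebraMap P₀ K₀ p) = g (algebraMap P₀ K₀ p)) : f = g :=
  IsLocalization.ringHom_ext (nonZeroDivisors P₀) (RingHom.ext h)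

/-- `permField 1 = id`. [cite: MochizukiAbsTopIII2015, Thm 1.9 p.38] -/
theorem permField_refl_apply (x : K₀) : permField (Equiv.refl E₀.arith) x = x := by
  have h : ((permField (Equiv.refl E₀.arith) : K₀ ≃ₐ[C₀] K₀) : K₀ →+* K₀) = RingHom.id K₀ :=
    ringHom_ext_K₀ fun p => by
      rw [RingHom.coe_coe, permField_algebraMap, RingHom.id_apply, Equiv.coe_refl, MvPolynomial.rename_id,
        AlgHom.id_apply]
  simpa using RingHom.congr_fun h x

/-- `permField (π ∘ ρ) = permField π ∘ permField ρ` (in diagrammatic order `π.trans ρ`).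
[cite: MochizukiAbsTopIII2015, Thm 1.9 p.38] -/
theorem permField_trans_apply (π ρ : Equiv.Perm E₀.arith) (x : K₀) :
    permField (π.trans ρ) x = permField ρ (permField π x) := by
  have h : ((permField (π.trans ρ) : K₀ ≃ₐ[C₀] K₀) : K₀ →+* K₀) =
      ((permField ρ : K₀ ≃ₐ[C₀] K₀) : K₀ →+* K₀).comp (permField π : K₀ ≃ₐ[C₀] K₀) :=
    ringHom_ext_K₀ fun p => by
      rw [RingHom.coe_coe, permField_algebraMap, RingHom.comp_apply, RingHom.coe_coe, RingHom.coe_coe,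
        permField_algebraMap, permField_algebraMap, MvPolynomial.rename_rename, Equiv.coe_trans]
  simpa using RingHom.congr_fun h x

/-- The permutation of `Π₀` underlying an automorphism of the extension `E₀`.
[cite: MochizukiAbsTopIII2015, Thm 1.9 p.38] -/
def arithPerm (α : E₀ ≅ E₀) : Equiv.Perm E₀.arith where
  toFun := α.hom.arith
  invFun := α.inv.arith
  left_inv x := congrFun (congrArg (fun f : E₀ ⟶ E₀ => (f.arith : E₀.arith → E₀.arith)) α.hom_inv_id) x
  right_inv x := congrFun (congrArg (fun f : E₀ ⟶ E₀ => (f.arith : E₀.arith → E₀.arith)) α.inv_hom_id) x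

/-- `arithPerm` is multiplicative. [cite: MochizukiAbsTopIII2015, Thm 1.9 p.38] -/
theorem arithPerm_trans (α β : E₀ ≅ E₀) : arithPerm (α ≪≫ β) = (arithPerm α).trans (arithPerm β) :=
  Equiv.ext fun _ => rfl

/-- `arithPerm` of the identity. [cite: MochizukiAbsTopIII2015, Thm 1.9 p.38] -/
theorem arithPerm_refl : arithPerm (Iso.refl E₀) = Equiv.refl _ :=
  Equiv.ext fun _ => rfl

/-- `arithPerm` of the inner isomorphism `innerIso g` is conjugation by `g`.
[cite: MochizukiAbsTopIII2015, Rmk 1.9.5 (i) p.39] -/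
theorem arithPerm_innerIso (g : E₀.arith) : arithPerm (E₀.innerIso g) = (MulAut.conj g).toEquiv :=
  Equiv.ext fun _ => rfl

/-! ### The transport: a functor from the groupoid of extensions to `Aut(K₀)` -/

open Classical in
/-- A CHOSEN isomorphism `E ≅ E₀` for every extension isomorphic to `E₀`, rigged to be the identity at `E₀`
itself. [cite: MochizukiAbsTopIII2015, Thm 1.9 p.38] -/
def anchor (E : FundamentalExtension.{0}) (h : Nonempty (E ≅ E₀)) : E ≅ E₀ :=
  if hE : E = E₀ then eqToIso hE else Classical.choice h

/-- At `E₀` the anchor is the identity. [cite: MochizukiAbsTopIII2015, Thm 1.9 p.38] -/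
theorem anchor_self (h : Nonempty (E₀ ≅ E₀)) : anchor E₀ h = Iso.refl E₀ := by
  simp [anchor]

open Classical in
/-- The transport of the toy algorithm along `e : E ≅ F`: trivial unless `E ≅ E₀`, and then the renaming of
`K₀` along the automorphism `(anchor E)⁻¹ ≫ e ≫ anchor F` of `E₀`. [cite: MochizukiAbsTopIII2015, Thm 1.9 p.38] -/
def toyMapFun {E F : FundamentalExtension.{0}} (e : E ≅ F) : K₀ ≃+* K₀ :=
  if hE : Nonempty (E ≅ E₀) then
    (permField (arithPerm ((anchor E hE).symm ≪≫ e ≪≫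
      anchor F ⟨e.symm ≪≫ Classical.choice hE⟩))).toRingEquiv
  else RingEquiv.refl K₀

/-- The transport fixes the constants `ℚ̄_NF`. [cite: MochizukiAbsTopIII2015, Thm 1.9 (d) p.38] -/
theorem toyMapFun_algebraMap {E F : FundamentalExtension.{0}} (e : E ≅ F) (c : C₀) :
    toyMapFun e (algebraMap C₀ K₀ c) = algebraMap C₀ K₀ c := by
  unfold toyMapFun
  split_ifs with hE
  · exact AlgEquiv.commutes _ c
  · rfl

/-- Functoriality: identities. [cite: MochizukiAbsTopIII2015, Thm 1.9 p.38] -/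
theorem toyMapFun_refl (E : FundamentalExtension.{0}) : toyMapFun (Iso.refl E) = RingEquiv.refl K₀ := by
  unfold toyMapFun
  split_ifs with hE
  · apply RingEquiv.ext
    intro x
    have h : (anchor E hE).symm ≪≫ Iso.refl E ≪≫ anchor E ⟨(Iso.refl E).symm ≪≫ Classical.choice hE⟩ =
        Iso.refl E₀ := by
      rw [Iso.refl_trans]
      exact Iso.symm_self_id _
    rw [h, arithPerm_refl]
    exact permField_refl_apply x
  · rfl

/-- Functoriality: composition. [cite: MochizukiAbsTopIII2015, Thm 1.9 p.38] -/
theorem toyMapFun_trans {E F K : FundamentalExtension.{0}} (e : E ≅ F) (f : F ≅ K) :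
    toyMapFun (e ≪≫ f) = (toyMapFun e).trans (toyMapFun f) := by
  unfold toyMapFun
  by_cases hE : Nonempty (E ≅ E₀)
  · have hF : Nonempty (F ≅ E₀) := ⟨e.symm ≪≫ Classical.choice hE⟩
    rw [dif_pos hE, dif_pos hE, dif_pos hF]
    apply RingEquiv.ext
    intro x
    have h : (anchor E hE).symm ≪≫ (e ≪≫ f) ≪≫ anchor K ⟨(e ≪≫ f).symm ≪≫ Classical.choice hE⟩ =
        ((anchor E hE).symm ≪≫ e ≪≫ anchor F hF) ≪≫
          ((anchor F hF).symm ≪≫ f ≪≫ anchor K ⟨f.symm ≪≫ Classical.choice hF⟩) := by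
      simp only [Iso.trans_assoc, Iso.self_symm_id_assoc]
    rw [h, arithPerm_trans]
    exact permField_trans_apply _ _ x
  · have hF : ¬ Nonempty (F ≅ E₀) := fun ⟨u⟩ => hE ⟨e ≪≫ u⟩
    rw [dif_neg hE, dif_neg hE, dif_neg hF]
    rfl

/-- At `E₀` the transport along `innerIso g` is renaming by conjugation by `g` — NOT the identity.
[cite: MochizukiAbsTopIII2015, Rmk 1.9.5 (i) p.39] -/
theorem toyMapFun_innerIso (g : E₀.arith) :
    toyMapFun (E₀.innerIso g) = (permField (MulAut.conj g).toEquiv).toRingEquiv := by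
  unfold toyMapFun
  rw [dif_pos ⟨Iso.refl E₀⟩]
  simp only [anchor_self, Iso.refl_symm, Iso.refl_trans, Iso.trans_refl, arithPerm_innerIso]

/-! ### The toy algorithm -/

/-- The output of the toy algorithm at ANY extension: one decomposition group `{1}`, no Belyi cuspidalizations,
constants `ℚ̄_NF`, function field `K₀`, Kummer container `K₀ˣ` with the identity as Kummer map.  Junk.
[cite: MochizukiAbsTopIII2015, Thm 1.9 p.37] -/
def toyObj (E : FundamentalExtension.{0}) : NFPortion E where
  nfPointDecomp := {⊥}
  Cover := PEmpty
  coverExt := fun c => c.elim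
  coverHom := fun c => c.elim
  constField := C₀
  functionField := K₀
  H1 := K₀ˣ
  kummer := MonoidHom.id _
  kummer_injective := fun _ _ h => h

open Classical in
/-- **The toy `NFPortionAlgorithm`**: constant output `toyObj`, transport `toyMapFun` (functorial), `comap` =
the inverse transport on isomorphisms and the identity on other open injections (so `comap_map` holds),
`comapBase` = identity. [cite: MochizukiAbsTopIII2015, Thm 1.9 p.37] -/
def toyAlg : NFPortionAlgorithm.{0} where
  obj := toyObj
  map e := { constEquiv := RingEquiv.refl _, funEquiv := toyMapFun e, comm := fun c => toyMapFun_algebraMap e c }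
  map_id E := toyMapFun_refl E
  map_comp e f := toyMapFun_trans e f
  comap f _ := if hf : IsIso f then ((toyMapFun (@asIso _ _ _ _ f hf)).symm : K₀ →+* K₀) else RingHom.id K₀
  comap_map e h x := by
    show (if hf : IsIso e.hom then ((toyMapFun (@asIso _ _ _ _ e.hom hf)).symm : K₀ →+* K₀)
      else RingHom.id K₀) (toyMapFun e x) = x
    rw [dif_pos (inferInstance : IsIso e.hom)]
    have he : @asIso _ _ _ _ e.hom (inferInstance : IsIso e.hom) = e := Iso.ext rfl
    rw [he]
    exact (toyMapFun e).symm_apply_apply x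
  comapBase _ _ := RingHom.id K₀

/-! ### The model and the recorded action -/

/-- abc-iut-f-076's `toyModel ℚ 𝔖₃` with `K_{Z_NF} := K₀`.  Junk (not a model of any curve).
[cite: MochizukiAbsTopIII2015, Thm 1.9 (d) p.37] -/
abbrev toyModelNV : CurveModel.{0} :=
  { toyModel ℚ S₃ with NFFunctionField := fun _ => K₀, instNFFunctionField := fun _ => inferInstance }

/-- The RECORDED action at the single curve: `g ↦` renaming by conjugation by `g`.
[cite: MochizukiAbsTopIII2015, Thm 1.9 (d)(e) pp.37-38] -/
def ρ₀ : toyModelNV.NFGaloisAction where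
  ι := PUnit
  curve _ := PUnit.unit
  act _ g := ((permField (MulAut.conj g).toEquiv : K₀ ≃ₐ[C₀] K₀) : K₀ →+* K₀)

/-- The single curve IS a Thm-1.9 input (strictly-Belyi flag `True`; `ℚ` is sub-`p`-adic).
[cite: MochizukiAbsTopIII2015, Thm 1.9 p.37] -/
theorem isThm19Input_toyModelNV (X : toyModelNV.Curve) : toyModelNV.IsThm19Input X :=
  ⟨trivial, IsSubpadic.of_isNF ⟨inferInstance⟩⟩

/-- **The recorded action MOVES an element**: conjugation by `(1, σ)` sends the variable `X_{(1,τ)}` to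
`X_{(1, στσ⁻¹)} ≠ X_{(1,τ)}` (`𝔖₃` is non-abelian). [cite: MochizukiAbsTopIII2015, Rmk 1.9.5 (i) p.39] -/
theorem ρ₀_moves : ∃ (g : (toyModelNV.ext (ρ₀.curve PUnit.unit)).arith)
    (f : toyModelNV.NFFunctionField (ρ₀.curve PUnit.unit)), ρ₀.act PUnit.unit g f ≠ f := by
  refine ⟨((1 : Field.absoluteGaloisGroup ℚ), σ), algebraMap P₀ K₀ (MvPolynomial.X ((1 : Field.absoluteGaloisGroup ℚ), τ)), ?_⟩
  intro h
  change permField (MulAut.conj (((1 : Field.absoluteGaloisGroup ℚ), σ) : E₀.arith)).toEquiv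
      (algebraMap P₀ K₀ (MvPolynomial.X _)) = algebraMap P₀ K₀ (MvPolynomial.X _) at h
  rw [permField_algebraMap, MvPolynomial.rename_X] at h
  have h2 := MvPolynomial.X_injective (IsFractionRing.injective P₀ K₀ h)
  have h3 := congrArg Prod.snd h2
  simp only [MulEquiv.toEquiv_eq_coe, MulEquiv.coe_toEquiv, MulAut.conj_apply, Prod.snd_mul, Prod.snd_inv]
    at h3
  have h4 : (σ * τ * σ⁻¹ : Equiv.Perm (Fin 3)) = τ := h3
  exact absurd h4 (by decide)

/-! ### The witness -/

/-- **`Thm_1_9'.WitnessedBy toyModelNV ρ₀ toyAlg`**: clauses (a) `{1} = {conjugates of D_x = 1}`, (d)(e) by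
identities, and inner equivariance with `φ := id` by `toyMapFun_innerIso`.
[cite: MochizukiAbsTopIII2015, Thm 1.9 pp.37-38] -/
theorem witnessedBy_toyAlg : Thm_1_9'.WitnessedBy toyModelNV ρ₀ toyAlg := by
  refine ⟨fun X _ => ⟨?_, ⟨RingEquiv.refl _⟩, ⟨RingEquiv.refl _⟩⟩, fun i _ => ?_⟩
  · ext D
    simp only [Set.mem_setOf_eq]
    constructor
    · intro hD
      refine ⟨PUnit.unit, 1, trivial, ?_⟩
      rw [map_one, one_smul]
      exact hD
    · rintro ⟨-, g, -, rfl⟩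
      exact Subgroup.smul_bot _
  · refine ⟨RingEquiv.refl _, fun g x => ?_⟩
    show toyMapFun (E₀.innerIso g) x = permField (MulAut.conj g).toEquiv x
    rw [toyMapFun_innerIso]
    rfl

/-- **`Thm_1_9'` HOLDS at `(toyModelNV, ρ₀)`.** [cite: MochizukiAbsTopIII2015, Thm 1.9 pp.37-38] -/
theorem thm_1_9'_toyModelNV : Thm_1_9' toyModelNV ρ₀ := ⟨toyAlg, witnessedBy_toyAlg⟩

/-- The toy algorithm is NOT inner-trivial at the recorded curve (by the tree's NEG lemma, since `ρ₀` moves an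
element; equivalently by `toyMapFun_innerIso`). [cite: MochizukiAbsTopIII2015, Rmk 1.9.5 (i) p.39] -/
theorem toyAlg_not_isInnerTrivialAt : ¬ toyAlg.IsInnerTrivialAt (toyModelNV.ext (ρ₀.curve PUnit.unit)) :=
  fun h => Thm_1_9'.not_witnessedBy_of_isInnerTrivialAt (A := toyAlg) (M := toyModelNV) (ρ := ρ₀) PUnit.unit
    (isThm19Input_toyModelNV _) h ρ₀_moves witnessedBy_toyAlg

end Thm19FunctorialNV

open Thm19FunctorialNV in
/-- **NON-DEGENERATE satisfiability of `Thm_1_9'`** (vacuity audit of the strengthened named fact, LANA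
Rem. 8.2.1 discipline): there are a model `M`, a recorded action `ρ`, an algorithm `A` and a recorded curve `i`
such that `A` witnesses `Thm_1_9'` at `(M, ρ)`, the curve IS a Thm-1.9 input, the recorded action MOVES an
element there, and `A` is NOT inner-trivial — the total functoriality fields (`map`, `comap`, `comap_map`,
`comapBase`) notwithstanding.  TOY data; certifies joint satisfiability of the typed clause, nothing about print.
[cite: MochizukiAbsTopIII2015, Thm 1.9 pp.37-38] -/
theorem Thm_1_9'.exists_witness_nondegenerate :
    ∃ (M : CurveModel.{0}) (ρ : M.NFGaloisAction) (A : NFPortionAlgorithm.{0}) (i : ρ.ι),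
      Thm_1_9'.WitnessedBy M ρ A ∧ M.IsThm19Input (ρ.curve i) ∧
        (∃ (g : (M.ext (ρ.curve i)).arith) (f : M.NFFunctionField (ρ.curve i)), ρ.act i g f ≠ f) ∧
        ¬ A.IsInnerTrivialAt (M.ext (ρ.curve i)) :=
  ⟨toyModelNV, ρ₀, toyAlg, PUnit.unit, witnessedBy_toyAlg, isThm19Input_toyModelNV _, ρ₀_moves,
    toyAlg_not_isInnerTrivialAt⟩

end Literature.AnabelianGeometry.AbsoluteAnabelian.AbsTopIII

end
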